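import Summits.AtomisticToContinuum.FouriersLaw.Theorems.BondHeatUncertaintyExtensiveSnapshotIrreversibilityNessDensityPosAux1
import Summits.AtomisticToContinuum.FouriersLaw.Theorems.OddSectorIrreversibilityResponseDensitySmoothForecast
import Summits.AtomisticToContinuum.FouriersLaw.Theorems.EmbeddedDrudeMourreNessUnique
import Mathlib.Analysis.Calculus.BumpFunction.FiniteDimension
import HarnessLib

/-!
# Crux `ExtensiveSnapshotIrreversibility` (stmt-AtomisticToContinuum-9121), line `clausius-budget-sound-window`:
sub-goal `ness_density_pos` (M0 of stub S1r) — strict positivity of the NESS density of the pinned chain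

The registered sub-goal `ness_density_pos` of the lead's checked skeleton of stub S1r
(`stub_logDensityRegularity`): EVERY weak steady state `μ` (`OscillatorChain.IsSteadyState`) of the pinned
anharmonic chain `pinnedChain ω₂ lam β γ` (all parameters positive, `N ≥ 1`, `T_L, T_R > 0`) has an everywhere
POSITIVE `C^∞` Lebesgue density. This is Rey-Bellet–Thomas 2002, Thm 2.1 (positivity clause) for the Langevin
chain, ported from the tree's proof for the auxiliary-field model (`ReyBelletThomas2002PosDensity.lean`):

* `langevin_exists_pos_density` — **every `y₀` is reached with positive density from somewhere**: for a
  confining chain with smooth potentials, if `P_1(x, dy) = p(x, y) dy` with `p` jointly continuous and `≥ 0`,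
  then for every `y₀` some `p(x₀, y₀) > 0`. By the Lebesgue duality `dx P_1(x, dy) = e^{2γ} dy P̂_1(y, dx)`
  (`LangevinChainReversal.lean`), `∫ φ(x) p(x, y) dx = e^{2γ} ∫ φ dP̂_1(y, ·)` for EVERY `y` (a.e. by testing,
  everywhere by continuity of both sides), and `P̂_1(y₀, ·)` is a probability measure;
* `ness_density_pos` — the assembly: the smooth density `ρ` of `μ` (Hörmander's theorem, proved in the tree,
  through `CuneoEckmannHairerReyBellet2018_smoothDensity_of_hormander`), invariance of `μ` under the constructed kernels
  (`pinnedChain_isInvariant_of_isSteadyState`), jointly smooth transition densities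
  (`pinnedChain_exists_transitionDensity`), irreducibility (`pinnedChain_transitionKernel_pos_of_isOpen`,
  helper file 1): `ρ(y₀) ≥ ∫ ρ(x) p_1(x, y₀) dx ≥ c μ(B(x₀, δ)) > 0`.

With the landed bridge `eq_gibbsMeasure_withDensity_exp_of_pos_density`
(`…LogDensityRegularityAux1.lean`) this makes clause (R1) of (R) a theorem: `μ_δ = μ_T · e^{φ_δ}` with `φ_δ = log ρ_δ + H/T + log Z_T`.

References: L. Rey-Bellet, L. E. Thomas, CMP 225 (2002) 305–329, Thm 2.1, §5; N. Cuneo, J.-P. Eckmann,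
M. Hairer, L. Rey-Bellet, EJP 23 (2018) no. 55, Thm 2.13, Prop. 3.2, Prop. 3.3.
-/

noncomputable section

open MeasureTheory ProbabilityTheory Filter Topology Set Metric Function
open scoped NNReal ENNReal ContDiff

namespace Summit.AtomisticToContinuum.FouriersLaw.Theorems.ExtensiveSnapshotIrreversibility.ClausiusBudget

open Literature.MathematicalPhysics.KineticTheory.HeatConduction
open Literature.MathematicalPhysics.KineticTheory Literature.Probability.Process OscillatorChain
open Summit.AtomisticToContinuum.FouriersLaw.Theorems.SubdiffusiveBondHeat

namespace LogDensity

variable {N : ℕ}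

/-! ## 1. For every `y₀` some `p_1(x₀, y₀) > 0`, by duality -/

/-- **Every `y₀` is reached with positive density from somewhere** (Langevin chain with confining smooth
potentials, `N ≥ 1`): if `P_1(x, dy) = p(x, y) dy` with `(x, y) ↦ p(x, y)` continuous and `≥ 0`, then for
every `y₀` there is `x₀` with `p(x₀, y₀) > 0` — by duality `∫ φ(x) p(x, y) dx = e^{2γ} ∫ φ dP̂_1(y, ·)` for
every `y` (a.e. by testing against `ψ(y)`, everywhere by continuity), and `P̂_1(y₀, ·)` is a probability
measure. [cite: ReyBelletThomas2002, Thm 2.1] -/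
theorem langevin_exists_pos_density {P : OscillatorChain} (hP : P.IsConfining) (hU : ContDiff ℝ ∞ P.U)
    (hV : ContDiff ℝ ∞ P.V) (hN : 0 < N) (T_L T_R : ℝ) {p : PhaseSpace N → PhaseSpace N → ℝ}
    (hpc : Continuous fun q : PhaseSpace N × PhaseSpace N => p q.1 q.2) (hp0 : ∀ x y, 0 ≤ p x y)
    (hpt : ∀ x, P.langevinKernel N T_L T_R 1 x =
      (volume : Measure (PhaseSpace N)).withDensity fun y => ENNReal.ofReal (p x y))
    (y₀ : PhaseSpace N) : ∃ x₀, 0 < p x₀ y₀ := by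
  haveI := isAddHaarMeasure_volume_phaseSpace N
  haveI : IsMarkovKernel (P.langevinRevKernel N T_L T_R 1) := hP.isMarkovKernel_langevinRevKernel N T_L T_R 1
  haveI : IsMarkovKernel (P.langevinKernel N T_L T_R 1) := hP.isMarkovKernel_langevinKernel N T_L T_R 1
  -- a large ball charged by `P̂_1(y₀, ·)`, and a smooth cut-off `φ = 1` on it
  set ν : Measure (PhaseSpace N) := P.langevinRevKernel N T_L T_R 1 y₀ with hν
  have hballs : Tendsto (fun n : ℕ => ν (closedBall (0 : PhaseSpace N) n)) atTop (𝓝 (ν univ)) := by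
    have hmono : Monotone fun n : ℕ => closedBall (0 : PhaseSpace N) n := fun m n hmn =>
      closedBall_subset_closedBall (by exact_mod_cast hmn)
    have hU' : ⋃ n : ℕ, closedBall (0 : PhaseSpace N) n = univ :=
      eq_univ_of_forall fun x => mem_iUnion.2 (by
        obtain ⟨n, hn⟩ := exists_nat_ge ‖x‖
        exact ⟨n, mem_closedBall_zero_iff.2 hn⟩)
    rw [← hU']
    exact tendsto_measure_iUnion_atTop hmono
  have hev : ∀ᶠ n : ℕ in atTop, (1 / 2 : ℝ≥0∞) < ν (closedBall (0 : PhaseSpace N) n) := by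
    refine hballs.eventually (lt_mem_nhds ?_)
    rw [measure_univ]; norm_num
  obtain ⟨n, hn⟩ := hev.exists
  let b : ContDiffBump (0 : PhaseSpace N) := ⟨n + 1, n + 2, by positivity, by linarith⟩
  set φ : PhaseSpace N → ℝ := fun x => b x with hφdef
  have hφs : ContDiff ℝ ∞ φ := b.contDiff
  have hφc : HasCompactSupport φ := b.hasCompactSupport
  have hφ0 : ∀ x, 0 ≤ φ x := fun x => b.nonneg
  have hφball : ∀ x ∈ closedBall (0 : PhaseSpace N) n, φ x = 1 := fun x hx =>
    b.one_of_mem_closedBall (closedBall_subset_closedBall (by show (n : ℝ) ≤ n + 1; linarith) hx)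
  -- the two sides, as functions of `y`
  set A : PhaseSpace N → ℝ := fun y => ∫ x, φ x * p x y with hA
  set B : PhaseSpace N → ℝ := fun y => ∫ x, φ x ∂(P.langevinRevKernel N T_L T_R 1 y) with hB
  obtain ⟨Cφ, hCφ⟩ := hφs.continuous.bounded_above_of_compact_support hφc
  have hBc : Continuous B := hP.continuous_integral_langevinRevKernel N T_L T_R 1 hφs.continuous hCφ
  have hAc : Continuous A := by
    refine continuous_iff_continuousAt.2 fun y₁ => ?_
    have hK : IsCompact (tsupport φ ×ˢ closedBall y₁ 1) := hφc.prod (isCompact_closedBall y₁ 1)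
    obtain ⟨M, hM⟩ := hK.exists_bound_of_continuousOn hpc.continuousOn
    have hφi : Integrable φ volume := hφs.continuous.integrable_of_hasCompactSupport hφc
    refine continuousAt_of_dominated (bound := fun x => ‖φ x‖ * max M 0) ?_ ?_ (hφi.norm.mul_const _) ?_
    · exact Eventually.of_forall fun y =>
        (hφs.continuous.mul (hpc.comp (Continuous.prodMk_left y))).aestronglyMeasurable
    · filter_upwards [closedBall_mem_nhds y₁ one_pos] with y hy
      refine Eventually.of_forall fun x => ?_
      rw [norm_mul]
      by_cases hx : x ∈ tsupport φ
      · exact mul_le_mul_of_nonneg_left ((hM (x, y) ⟨hx, hy⟩).trans (le_max_left _ _)) (norm_nonneg _)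
      · rw [image_eq_zero_of_notMem_tsupport hx, norm_zero, zero_mul, zero_mul]
    · exact Eventually.of_forall fun x => (continuous_const.mul (hpc.comp (Continuous.prodMk_right x))).continuousAt
  -- testing against `ψ(y)`: `∫ ψ (A - e^{2γ} B) = 0`
  have htest : ∀ ψ : PhaseSpace N → ℝ, ContDiff ℝ ∞ ψ → HasCompactSupport ψ →
      ∫ y, ψ y • (A y - Real.exp (2 * P.γ * ((1 : ℝ≥0) : ℝ)) * B y) = 0 := by
    intro ψ hψ hψc
    set H : PhaseSpace N × PhaseSpace N → ℝ := fun q => φ q.1 * ψ q.2 with hH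
    have hHc : Continuous H := (hφs.continuous.comp continuous_fst).mul (hψ.continuous.comp continuous_snd)
    have hHs : HasCompactSupport H := by
      refine IsCompact.of_isClosed_subset (hφc.isCompact.prod hψc.isCompact) (isClosed_tsupport _) ?_
      refine closure_minimal (fun q hq => ?_) ((isClosed_tsupport _).prod (isClosed_tsupport _))
      have h := Function.mem_support.1 hq
      exact ⟨subset_tsupport _ (Function.mem_support.2 (left_ne_zero_of_mul h)),
        subset_tsupport _ (Function.mem_support.2 (right_ne_zero_of_mul h))⟩
    have hint : Integrable H ((volume : Measure (PhaseSpace N)) ⊗ₘ P.langevinKernel N T_L T_R 1) :=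
      (hP.confinedDrift N).toConfinedDrift.integrable_compProd_pair (hP.bathVecL_mem_noise N T_L)
        (hP.bathVecR_mem_noise N T_R) volume hHc hHs 1
    obtain ⟨-, hdual⟩ := hP.integral_langevinKernel_duality (T_L := T_L) (T_R := T_R) hU hV hN one_pos hint
    -- the left side: density and Fubini
    have hinner : ∀ x, ∫ y, H (x, y) ∂(P.langevinKernel N T_L T_R 1 x) = φ x * ∫ y, p x y * ψ y := by
      intro x
      simp only [hH]
      rw [integral_const_mul, hpt x]
      congr 1
      have hmf : Measurable fun y => (p x y).toNNReal :=
        (hpc.comp (Continuous.prodMk_right x)).measurable.real_toNNReal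
      have h2 := integral_withDensity_eq_integral_smul (μ := (volume : Measure (PhaseSpace N))) hmf ψ
      show ∫ a, ψ a ∂((volume : Measure (PhaseSpace N)).withDensity fun y => ((p x y).toNNReal : ℝ≥0∞)) = _
      rw [h2]
      refine integral_congr_ae (Eventually.of_forall fun y => ?_)
      simp only [NNReal.smul_def, smul_eq_mul, Real.coe_toNNReal _ (hp0 x y)]
    have hprod : Integrable (fun q : PhaseSpace N × PhaseSpace N => φ q.1 * (p q.1 q.2 * ψ q.2))
        ((volume : Measure (PhaseSpace N)).prod volume) := by
      have hc : Continuous fun q : PhaseSpace N × PhaseSpace N => φ q.1 * (p q.1 q.2 * ψ q.2) :=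
        (hφs.continuous.comp continuous_fst).mul (hpc.mul (hψ.continuous.comp continuous_snd))
      refine hc.integrable_of_hasCompactSupport ?_
      refine IsCompact.of_isClosed_subset (hφc.isCompact.prod hψc.isCompact) (isClosed_tsupport _) ?_
      refine closure_minimal (fun q hq => ?_) ((isClosed_tsupport _).prod (isClosed_tsupport _))
      have h := Function.mem_support.1 hq
      exact ⟨subset_tsupport _ (Function.mem_support.2 (left_ne_zero_of_mul h)),
        subset_tsupport _ (Function.mem_support.2 (right_ne_zero_of_mul (right_ne_zero_of_mul h)))⟩
    have hleft : ∫ x, ∫ y, H (x, y) ∂(P.langevinKernel N T_L T_R 1 x) = ∫ y, ψ y * A y := by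
      simp_rw [hinner]
      have h1 : ∀ x, φ x * ∫ y, p x y * ψ y = ∫ y, φ x * (p x y * ψ y) := fun x => (integral_const_mul _ _).symm
      simp_rw [h1]
      rw [integral_integral_swap hprod]
      refine integral_congr_ae (Eventually.of_forall fun y => ?_)
      simp only [hA]
      rw [← integral_const_mul]
      refine integral_congr_ae (Eventually.of_forall fun x => ?_)
      ring
    have hright : ∫ y, ∫ x, H (x, y) ∂(P.langevinRevKernel N T_L T_R 1 y) = ∫ y, ψ y * B y := by
      refine integral_congr_ae (Eventually.of_forall fun y => ?_)
      simp only [hH, hB]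
      rw [← integral_const_mul]
      refine integral_congr_ae (Eventually.of_forall fun x => ?_)
      ring
    rw [hleft, hright, ← integral_const_mul] at hdual
    have hiA : Integrable (fun y => ψ y * A y) := (hψ.continuous.mul hAc).integrable_of_hasCompactSupport hψc.mul_right
    have hiB : Integrable (fun y => Real.exp (2 * P.γ * ((1 : ℝ≥0) : ℝ)) * (ψ y * B y)) :=
      ((hψ.continuous.mul hBc).integrable_of_hasCompactSupport hψc.mul_right).const_mul _
    simp only [smul_eq_mul, mul_sub]
    have e : (fun y => ψ y * (Real.exp (2 * P.γ * ((1 : ℝ≥0) : ℝ)) * B y)) =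
        fun y => Real.exp (2 * P.γ * ((1 : ℝ≥0) : ℝ)) * (ψ y * B y) := funext fun y => by ring
    rw [integral_sub hiA (by rw [e]; exact hiB), e, hdual, sub_self]
  -- a.e., then everywhere by continuity
  have hcont : Continuous fun y => A y - Real.exp (2 * P.γ * ((1 : ℝ≥0) : ℝ)) * B y :=
    hAc.sub (continuous_const.mul hBc)
  have hae := ae_eq_zero_of_integral_contDiff_smul_eq_zero hcont.locallyIntegrable htest
  have hae' : (fun y => A y - Real.exp (2 * P.γ * ((1 : ℝ≥0) : ℝ)) * B y) =ᵐ[volume] fun _ => (0 : ℝ) := hae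
  have hfun := (Continuous.ae_eq_iff_eq (volume : Measure (PhaseSpace N)) hcont continuous_const).1 hae'
  have hzero : A y₀ = Real.exp (2 * P.γ * ((1 : ℝ≥0) : ℝ)) * B y₀ := sub_eq_zero.1 (congrFun hfun y₀)
  -- `B y₀ > 0`
  have hBpos : 0 < B y₀ := by
    have hφi : Integrable φ ν :=
      (integrable_const Cφ).mono' hφs.continuous.aestronglyMeasurable (Eventually.of_forall fun x => hCφ x)
    have hind : Integrable ((closedBall (0 : PhaseSpace N) n).indicator fun _ => (1 : ℝ)) ν :=
      (integrable_const 1).indicator measurableSet_closedBall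
    have hle : ∫ x, (closedBall (0 : PhaseSpace N) n).indicator (fun _ => (1 : ℝ)) x ∂ν ≤ ∫ x, φ x ∂ν := by
      refine integral_mono hind hφi fun x => ?_
      by_cases hx : x ∈ closedBall (0 : PhaseSpace N) n
      · rw [indicator_of_mem hx, hφball x hx]
      · rw [indicator_of_notMem hx]; exact hφ0 x
    rw [integral_indicator_const _ measurableSet_closedBall, smul_eq_mul, mul_one] at hle
    have hreal : 0 < ν.real (closedBall (0 : PhaseSpace N) n) := by
      rw [measureReal_def]
      refine ENNReal.toReal_pos ?_ (measure_ne_top _ _)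
      exact (lt_trans (by norm_num) hn).ne'
    exact hreal.trans_le hle
  have hApos : 0 < A y₀ := by rw [hzero]; exact mul_pos (Real.exp_pos _) hBpos
  -- some `p(x₀, y₀) > 0`
  by_contra hall
  have hall' : ∀ x, p x y₀ ≤ 0 := fun x => not_lt.1 fun h => hall ⟨x, h⟩
  have hp00 : ∀ x, p x y₀ = 0 := fun x => le_antisymm (hall' x) (hp0 x y₀)
  have hA0 : A y₀ = 0 := by
    simp only [hA, hp00, mul_zero, integral_zero]
  exact hApos.ne' hA0

/-! ## 2. The registered sub-goal: strict positivity of the NESS density -/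

/-- **Strict positivity of the NESS density** (sub-goal M0 of stub S1r; Rey-Bellet–Thomas 2002, Thm 2.1 for
the Langevin chain): every weak steady state of the pinned anharmonic chain (`ω₂, lam, β, γ > 0`, `N ≥ 1`,
`T_L, T_R > 0`) has an everywhere positive `C^∞` Lebesgue density. The smooth density `ρ` (Hörmander) is
invariant under the constructed kernels, which have jointly continuous densities `p_t(x, y)` and are
irreducible; `ρ(y₀) ≥ ∫ ρ(x) p_1(x, y₀) dx ≥ (p_1(x₀, y₀)/2) μ(B(x₀, δ)) > 0` with `p_1(x₀, y₀) > 0` from the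
Lebesgue duality. [cite: ReyBelletThomas2002, Thm 2.1] -/
theorem ness_density_pos :
    ∀ ω₂ lam β γ : ℝ, 0 < ω₂ → 0 < lam → 0 < β → 0 < γ → ∀ (N : ℕ), 0 < N →
      ∀ T_L T_R : ℝ, 0 < T_L → 0 < T_R → ∀ μ : Measure (PhaseSpace N),
        (pinnedChain ω₂ lam β γ).IsSteadyState N T_L T_R μ →
        ∃ ρ : PhaseSpace N → ℝ, ContDiff ℝ (⊤ : ℕ∞) ρ ∧ (∀ x, 0 < ρ x) ∧
          μ = (volume : Measure (PhaseSpace N)).withDensity (fun x => ENNReal.ofReal (ρ x)) := by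
  intro ω₂ lam β γ hω hl hβ hγ N hN T_L T_R hL hR μ hμ
  set P := pinnedChain ω₂ lam β γ with hPdef
  haveI : IsProbabilityMeasure μ := hμ.1
  have hPc : P.IsConfining := pinnedChain_isConfining hω hl.le hβ.le hγ.le
  -- the smooth density (Hörmander's theorem through the CEHR bracket condition)
  obtain ⟨ρ, hρs, -, hμρ⟩ : HasSmoothDensity μ :=
    CuneoEckmannHairerReyBellet2018_smoothDensity_of_hormander
      Literature.Analysis.Hypoelliptic.hormander1967_thm11_proof ω₂ lam β γ hω hl.le hβ hγ N T_L T_R hN hL hR μ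
      inferInstance hμ.2.1
  -- invariance under the constructed kernels (Fokker–Planck identification)
  have hinv : ∀ t : ℝ≥0, μ.bind (P.transitionKernel N T_L T_R t) = μ := fun t =>
    pinnedChain_isInvariant_of_isSteadyState hω hl hβ hγ hN hL hR hμ t
  -- jointly continuous transition densities
  obtain ⟨p, hp, hp0, hpk⟩ := pinnedChain_exists_transitionDensity (T_L := T_L) (T_R := T_R)
    hω hl.le hβ.le hγ hN hL hR.le
  have hp1 : Continuous fun q : PhaseSpace N × PhaseSpace N => p 1 q.1 q.2 := by
    have h1 : ContinuousOn (fun q : PhaseSpace N × PhaseSpace N => ((1 : ℝ), q)) univ :=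
      (Continuous.prodMk_right (1 : ℝ)).continuousOn
    exact continuousOn_univ.1
      (hp.continuousOn.comp h1 fun q _ => ⟨(zero_lt_one : (0 : ℝ) < 1), mem_univ _⟩)
  have hpt1 : ∀ x, P.transitionKernel N T_L T_R 1 x =
      (volume : Measure (PhaseSpace N)).withDensity fun y => ENNReal.ofReal (p 1 x y) := fun x => by
    simpa using hpk 1 one_pos x
  have hpt1' : ∀ x, P.langevinKernel N T_L T_R 1 x =
      (volume : Measure (PhaseSpace N)).withDensity fun y => ENNReal.ofReal (p 1 x y) := fun x => by
    rw [pinnedChain_langevinKernel_eq_transitionKernel N T_L T_R hω hl.le hβ.le hγ.le 1]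
    exact hpt1 x
  refine ⟨ρ, hρs, fun y₀ => ?_, hμρ⟩
  -- some `p_1(x₀, y₀) > 0` (duality), and a ball around `x₀` where `p_1(·, y₀) ≥ p_1(x₀, y₀)/2`
  obtain ⟨x₀, hx₀⟩ := langevin_exists_pos_density hPc (pinnedChain_contDiff_U ω₂ lam β γ)
    (pinnedChain_contDiff_V ω₂ lam β γ) hN T_L T_R hp1 (hp0 1 one_pos) hpt1' y₀
  have hcx : ContinuousAt (fun x => p 1 x y₀) x₀ := (hp1.comp (Continuous.prodMk_left y₀)).continuousAt
  obtain ⟨δ, hδ, hball⟩ := Metric.continuousAt_iff.1 hcx (p 1 x₀ y₀ / 2) (by positivity)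
  have hlow : ∀ x ∈ ball x₀ δ, p 1 x₀ y₀ / 2 ≤ p 1 x y₀ := by
    intro x hx
    have h := hball hx
    rw [Real.dist_eq, abs_lt] at h
    linarith [h.1]
  -- the invariant measure charges the ball (irreducibility)
  have hμB : 0 < μ (ball x₀ δ) :=
    measure_pos_of_forall_kernel_pos (hinv 1) measurableSet_ball fun z =>
      pinnedChain_transitionKernel_pos_of_isOpen ω₂ lam β γ hω hl.le hβ.le hγ N hN T_L T_R hL hR 1 one_pos
        z _ isOpen_ball ⟨x₀, mem_ball_self hδ⟩
  have hmeas : Measurable fun x => ENNReal.ofReal (p 1 x y₀) :=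
    ENNReal.measurable_ofReal.comp (hp1.comp (Continuous.prodMk_left y₀)).measurable
  -- `ρ(y₀) ≥ ∫ ρ(x) p_1(x, y₀) dx ≥ (p_1(x₀, y₀)/2) μ(B(x₀, δ)) > 0`
  refine density_pos_of_lintegral_pos (hinv 1) hρs.continuous hμρ hp1 hpt1 y₀ ?_
  calc (0 : ℝ≥0∞) < ENNReal.ofReal (p 1 x₀ y₀ / 2) * μ (ball x₀ δ) :=
        ENNReal.mul_pos (ENNReal.ofReal_pos.2 (by positivity)).ne' hμB.ne'
    _ = ∫⁻ _ in ball x₀ δ, ENNReal.ofReal (p 1 x₀ y₀ / 2) ∂μ := by rw [setLIntegral_const]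
    _ ≤ ∫⁻ x in ball x₀ δ, ENNReal.ofReal (p 1 x y₀) ∂μ :=
        setLIntegral_mono hmeas fun x hx => ENNReal.ofReal_le_ofReal (hlow x hx)
    _ ≤ ∫⁻ x, ENNReal.ofReal (p 1 x y₀) ∂μ := setLIntegral_le_lintegral _ _

end LogDensity

end Summit.AtomisticToContinuum.FouriersLaw.Theorems.ExtensiveSnapshotIrreversibility.ClausiusBudget

end
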